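import Summits.Schanuel.Schanuel.Theorems.RootDecomp1ERadixCell06

/-!
# RootDecomp1ERadixCell — lens 2, generation 42 «THE FINITE-ORDER RADIX-2 CELL: count CONJUGATES, not degree» (lanes E-R19 (i) T below hyper + (iii) the transcendental weight log 2): S ITSELF on the pure-radix class {z_l = (v_l·log 2)·T^{e_l}, T real of FIXED finite exponential order} HYPOTHESIS-FREE and on the mixed radix class {z_l = (u_l + v_l log 2)·T^{e_l}} mod the ONE tree fact hX = ExplicitRatExpApprox — the Kummer-direction degree is paid by COUNTING the 𝔐 conjugates of 2^{1/𝔐} through the resultant norm Res_Y(Y^𝔐 − 2, F), never by a pair measure — continuation (RootDecomp1ERadixCell07): §6 classes, S on them, cells of the 1E items, members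

(lens-2 g42 HOME kernel RadixCell.lean d9530aae…, 1851 l, imports tree RootDecomp1EUntwistedWall04 + RootDecomp1KFiniteOrderCell02 only; CLAIM L2067, ACK + CHECKLIST E-g42 L2069, NODE L2089 / REQUEST L2090, critic VERDICT L2095 (crit g8: CLEARED — ONE CELL, tiers 1+2 = one cell; lens-2 tally CELL ×4 (g37, g39, g41, g42); E-R20 closes the radix line; PORT GO `--supports stmt-Schanuel-31410`); port by census-1 gen 18 as `RootDecomp1ERadixCell01`–`08` along K's sections: 01 = §1 the radix field ℚ(2^{1/𝔐}) (`croot`, `zroot`, `broot`, `irreducible_X_pow_sub_two`, degree 𝔐); 02 = §2 the two-level polynomial, conjugate factors `Gfac`, the RESULTANT NORM `resNorm` (`map_resNorm` = ∏ conjugates, `resNorm_ne_zero`, degree / value / Mahler-measure bounds); 03 = §3 the radix curve point `radixPt`, germs, fibres, root and residue avoidance at transcendental parameters; 04 = §4 integral exponents at the collapse (`Mden`, `Aexp`, `Bexp`, the value of G₀, from avoidance to the hypotheses of `resNorm_ne_zero`); 05 = §5 THE PURE-RADIX ENGINE `algebraicIndependent_radixPt_pure` (hypothesis-free, `endgame_pure`)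 + §5b mixed-engine helpers; 06 = §5b THE MIXED ENGINE `algebraicIndependent_radixPt (hX)` (one 320-line theorem, scoped `maxHeartbeats 800000` carried as in K); 07 = §6 classes `InPureRadixClass` / `InRadixClass`, `schanuel_inPureRadixClass` (hyp-free) / `schanuel_inRadixClass (hX)`, cells `cell_31410(_pure)` / `cell_25020(_pure)`, members `zLog2Curve` / `zMix` at tower numbers; 08 = §6 items AT the members + separation (`zMix_not_inPointClass`, `zLog2Curve_not_inPointClass`, `zMix_separation`).
PORT EDITS: 37 one-line docstrings added; five generic helpers made `private` against dedup twins (`mahlerMeasure_finset_prod`, `eval_map_intCast`, `aeval_ne_zero_of_transcendental`, `addNat_eq_natAdd`, `transcendental_log_two` ≡ tree AclSubsetLogFreeCore/Negative) with per-part private copies; statements and proofs verbatim; after the dedup bounce of 05 (p828625: `exists_int_relation` ≡ tree `RootDecomp1BRadicalDescent.exists_int_relation`, RadicalDescent03) K's copy was DELETED and the tree declaration is reused via `import …RootDecomp1BRadicalDescent03` + `open … (exists_int_relation)` in 05/06. `--supports stmt-Schanuel-31410`; no census credit carried; rung 0 — nothing here proves Schanuel.)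
-/

noncomputable section

open Complex Polynomial IntermediateField Filter
open scoped BigOperators Topology

namespace Summit.Schanuel.Schanuel.Theorems.RootDecomp1ERadixCell

open Summit.Schanuel.Schanuel.Theorems.RootDecomp1EUntwistedWall (gι gaussPt expo coef tail fib IsZ wden wden_pos
  isZ_expo Wb Wb_nonneg abs_expo_le abs_coef_le expo_eq_of_tail_eq sum_coef_fibre_cast fib_ne_zero diffPoly
  diffPoly_ne_zero eval_diffPoly gι_expo_sub gι_injective tail_eq_of_expo_eq eq_of_tail_eq_of_zero_eq coef_cast
  IsZ.add IsZ.mul IsZ.natCast IsZ.sum isZ_wden_fst isZ_wden_snd InGaussCurveClass)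
open Summit.Schanuel.Schanuel.Theorems.RootDecomp1EPointTransfer (InPointClass)
open Summit.Schanuel.Schanuel.Theorems.RootDecomp1ETwoScale (InTwoScaleClass)
open Summit.Schanuel.Schanuel.Theorems.RootDecomp1EWallDichotomy (InTwistedFrameClass)
open Summit.Schanuel.Schanuel.Theorems.RootDecomp1KHyper
open Summit.Schanuel.Schanuel.Theorems.RootDecomp1KHyper.HyperCell
open Summit.Schanuel.Schanuel.Theorems.RootDecomp1KGeneric (LiouvilleOrder)
open Summit.Schanuel.Schanuel.Theorems.RootDecomp1KFiniteOrderCell (towerNumber liouvilleOrder_towerNumber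
  not_hyperLiouville_towerNumber towerNumber_pos not_liouvilleOrder_towerNumber)
open Summit.Schanuel.Schanuel.Theorems.RootDecomp1BDefectFloorCells (natCast_le_trdeg_of_algebraicIndependent)

/-! ## §6  THE PURE-RADIX CLASS, `S` ITSELF on it (hypothesis-free), the CELLS of the live 1E items, MEMBERS -/

section Cells

variable {n : ℕ}

/-- **`InPureRadixClass z` — the cell line of Tier 1.**  `z_l = (v_l · log 2) · T^{e_l}` with `v_l ∈ ℚ_{≥0}`
(`v_l = 0` where `e_l = 0`), `e_l ∈ ℕ`, along ONE real parameter `T > 0` of FINITE exponential order `Σ_l e_l + 3`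
(`LiouvilleOrder`, NOT hyper-Liouville), the monomials `(i v_l) X^{e_l}` being `ℤ`-free in `ℂ[X]` (g41 freeness). -/
def InPureRadixClass {n : ℕ} (z : Fin n → ℂ) : Prop :=
  ∃ (T : ℝ) (v : Fin n → ℚ) (e : Fin n → ℕ), 0 < T ∧ LiouvilleOrder ((∑ l, e l) + 3) T ∧ (∀ l, 0 ≤ v l) ∧
    (∀ l, e l = 0 → v l = 0) ∧
    LinearIndependent ℤ (fun l : Fin n => Polynomial.monomial (e l) (gι ((0 : ℚ), v l))) ∧
    ∀ l, z l = ρι ((0 : ℚ), v l) * (T : ℂ) ^ (e l)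

/-- **CELL THEOREM (Tier 1) — `S` ITSELF on the pure-radix class, HYPOTHESIS-FREE**: the `n` numbers
`2^{v_l T^{e_l}} = e^{z_l}` alone are algebraically independent, so `trdeg ℚ(z, e^z) ≥ n`. -/
theorem schanuel_inPureRadixClass (n : ℕ) (z : Fin n → ℂ) (hz : InPureRadixClass z) : SB n z := by
  obtain ⟨T, v, e, hT0, hT, hv, hv0, hLI, hz⟩ := hz
  have hai : AlgebraicIndependent ℚ (radixPt (fun l => ((0 : ℚ), v l)) e (T : ℂ) ∘ Fin.succ) :=
    (algebraicIndependent_radixPt_pure (fun l => ((0 : ℚ), v l)) e hT0 hT (fun _ => rfl) hv hv0 hLI).comp _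
      (Fin.succ_injective n)
  refine natCast_le_trdeg_of_algebraicIndependent hai fun i => IntermediateField.subset_adjoin ℚ _ (Or.inr ⟨i, ?_⟩)
  simp only [Function.comp_apply, radixPt_succ, hz i]

/-- `S`'s LITERAL SHAPE on the pure class (the summit's binder `LinearIndependent ℚ z` carried, unused; `SB n z` is
by definition `(n : Cardinal) ≤ trdeg ℚ ℚ(z, e^z)`, tree abbrev `RootDecomp1KHyper.SB`). HYPOTHESIS-FREE. -/
theorem schanuel_shape_inPureRadixClass : ∀ (n : ℕ) (z : Fin n → ℂ), LinearIndependent ℚ z →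
    InPureRadixClass z →
      (n : Cardinal) ≤ Algebra.trdeg ℚ
        ↥(IntermediateField.adjoin ℚ (Set.range z ∪ Set.range (Complex.exp ∘ z))) :=
  fun n z _ hcl => schanuel_inPureRadixClass n z hcl

/-- **CELL of item 25020 `DefectOneSchanuel`** — binders VERBATIM, ONE class line `InPureRadixClass z`;
HYPOTHESIS-FREE (one line from `S` itself on the class). -/
theorem cell_25020_pure : ∀ (n : ℕ) (z : Fin n → ℂ), LinearIndependent ℚ z →
    InPureRadixClass z →
      (n : Cardinal) ≤ Algebra.trdeg ℚ
        ↥(IntermediateField.adjoin ℚ (Set.range z ∪ Set.range (Complex.exp ∘ z))) + 1 :=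
  fun n z _ hcl => (schanuel_inPureRadixClass n z hcl).trans le_self_add

/-- **CELL of item 31410 `PlainDefectOne`** — binders VERBATIM (the no-stabiliser and first-failure hypotheses
CARRIED, not consumed), ONE class line `InPureRadixClass z`; HYPOTHESIS-FREE. -/
theorem cell_31410_pure : ∀ (n : ℕ) (z : Fin n → ℂ), LinearIndependent ℚ z →
    (∀ β : ℂ, IsAlgebraic ℚ β → (∀ i, β * z i ∈ Submodule.span ℚ (Set.range z)) →
      β ∈ Set.range (algebraMap ℚ ℂ)) →
    (∀ (m : ℕ) (w : Fin m → ℂ), m < n → LinearIndependent ℚ w →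
      (∀ j, w j ∈ Submodule.span ℚ (Set.range z)) →
        (m : Cardinal) ≤ Algebra.trdeg ℚ
          ↥(IntermediateField.adjoin ℚ (Set.range w ∪ Set.range (Complex.exp ∘ w))) + 1) →
    InPureRadixClass z →
      (n : Cardinal) ≤ Algebra.trdeg ℚ
        ↥(IntermediateField.adjoin ℚ (Set.range z ∪ Set.range (Complex.exp ∘ z))) + 1 :=
  fun n z hli _ _ hcl => cell_25020_pure n z hli hcl

/-! ### The explicit members: the `log 2`-twisted moment curves at the tower numbers -/

/-- The `log 2`-twisted moment curve `(log 2 · T, log 2 · T², …, log 2 · Tⁿ)`. -/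
def zLog2Curve (n : ℕ) (T : ℝ) : Fin n → ℂ := fun j => ρι ((0 : ℚ), (1 : ℚ)) * (T : ℂ) ^ ((j : ℕ) + 1)

/-- Coordinates of the `log 2`-twisted moment curve: `z_j = log 2 · T^{j+1}`. -/
theorem zLog2Curve_apply (n : ℕ) (T : ℝ) (j : Fin n) :
    zLog2Curve n T j = ((Real.log 2 : ℝ) : ℂ) * (T : ℂ) ^ ((j : ℕ) + 1) := by
  simp [zLog2Curve, ρι, ρr]

/-- `e^{z_j} = 2^{T^{j+1}}` along the twisted moment curve (real powers of `2`). -/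
theorem exp_zLog2Curve (n : ℕ) (T : ℝ) (j : Fin n) :
    cexp (zLog2Curve n T j) = (((2 : ℝ) ^ (T ^ ((j : ℕ) + 1) : ℝ) : ℝ) : ℂ) := by
  rw [zLog2Curve_apply, Real.rpow_def_of_pos two_pos, Complex.ofReal_exp]
  push_cast
  ring_nf

/-- Monomials `i·X^{j+1}` (`j < n`) are `ℤ`-free (distinct degrees). -/
theorem linearIndependent_momentMonomials (n : ℕ) :
    LinearIndependent ℤ (fun j : Fin n => Polynomial.monomial ((j : ℕ) + 1) (gι ((0 : ℚ), (1 : ℚ)))) := by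
  have hI : gι ((0 : ℚ), (1 : ℚ)) = I := by simp [gι]
  rw [hI, Fintype.linearIndependent_iff]
  intro c hc j
  have h := congrArg (fun p : ℂ[X] => p.coeff ((j : ℕ) + 1)) hc
  simp only [Polynomial.finsetSum_coeff, Polynomial.coeff_smul, Polynomial.coeff_monomial,
    Polynomial.coeff_zero] at h
  rw [Finset.sum_eq_single j] at h
  · simp only [if_true, zsmul_eq_mul, mul_eq_zero, I_ne_zero, or_false, Int.cast_eq_zero] at h
    exact h
  · intro j' _ hj'
    rw [if_neg]
    · simp
    · intro hjj
      exact hj' (Fin.ext (by omega))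
  · intro hj; exact (hj (Finset.mem_univ j)).elim

/-- The twisted moment curve at `T > 0` of exponential order `n(n+1)/2 + 3` lies in the pure-radix class. -/
theorem zLog2Curve_mem {n : ℕ} {T : ℝ} (hT0 : 0 < T)
    (hT : LiouvilleOrder ((∑ j : Fin n, ((j : ℕ) + 1)) + 3) T) : InPureRadixClass (zLog2Curve n T) :=
  ⟨T, fun _ => 1, fun j => (j : ℕ) + 1, hT0, hT, fun _ => zero_le_one, fun _ h => (Nat.succ_ne_zero _ h).elim,
    linearIndependent_momentMonomials n, fun _ => rfl⟩

/-- **HEADLINE MEMBER THEOREM (hypothesis-free, finite order, transcendental weight):** Schanuel's conclusion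
`trdeg_ℚ ℚ(z, e^z) ≥ n` for `z = (log 2·T, …, log 2·Tⁿ)`, i.e. `2^T, 2^{T²}, …, 2^{Tⁿ}` are algebraically
independent, at EVERY real `T > 0` of exponential order `n(n+1)/2 + 3`. -/
theorem schanuel_zLog2Curve {n : ℕ} {T : ℝ} (hT0 : 0 < T)
    (hT : LiouvilleOrder ((∑ j : Fin n, ((j : ℕ) + 1)) + 3) T) : SB n (zLog2Curve n T) :=
  schanuel_inPureRadixClass n _ (zLog2Curve_mem hT0 hT)

/-- **THE NAMED MEMBER**: the tower number `T_{k+1}` of lens 1 (`towerNumber`), `k = n(n+1)/2 + 3`, is a real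
`> 0` of exponential order `k` and NOT hyper-Liouville (`not_hyperLiouville_towerNumber`): the twisted moment
curve there is a NAMED point of the class OUTSIDE every hyper-Liouville cell of the lineage. -/
theorem schanuel_zLog2Curve_towerNumber (n : ℕ) :
    SB n (zLog2Curve n (towerNumber ((∑ j : Fin n, ((j : ℕ) + 1)) + 3 + 1))) ∧
      ¬ HyperLiouville (towerNumber ((∑ j : Fin n, ((j : ℕ) + 1)) + 3 + 1)) :=
  ⟨schanuel_zLog2Curve (towerNumber_pos (by omega)) (liouvilleOrder_towerNumber _),
    not_hyperLiouville_towerNumber (by omega)⟩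

/-! ### Tier 2: the MIXED radix class (mod `hX`) and the twin members `(T, log 2·T, T², log 2·T², …)` -/

/-- **`InRadixClass z` — the cell line of Tier 2.**  `z_l = (u_l + v_l · log 2) · T^{e_l}` with `u_l, v_l ∈ ℚ_{≥0}`
(`v_l = 0` where `e_l = 0`), along ONE real `T > 0` of FINITE exponential order `13·Σ_l e_l + 4`, the monomials
`(u_l + i v_l) X^{e_l}` `ℤ`-free in `ℂ[X]` (g41 freeness VERBATIM; the pair `(u_l, v_l) ∈ ℚ²` is encoded as the
Gaussian rational `gι (u_l, v_l) = u_l + i v_l` — a bookkeeping proxy for `u_l + v_l log 2`, exact for freeness). -/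
def InRadixClass {n : ℕ} (z : Fin n → ℂ) : Prop :=
  ∃ (T : ℝ) (w : Fin n → ℚ × ℚ) (e : Fin n → ℕ), 0 < T ∧ LiouvilleOrder (13 * (∑ l, e l) + 4) T ∧
    (∀ l, 0 ≤ (w l).1) ∧ (∀ l, 0 ≤ (w l).2) ∧ (∀ l, e l = 0 → (w l).2 = 0) ∧
    LinearIndependent ℤ (fun l : Fin n => Polynomial.monomial (e l) (gι (w l))) ∧
    ∀ l, z l = ρι (w l) * (T : ℂ) ^ (e l)

/-- **CELL THEOREM (Tier 2) — `S` ITSELF on the mixed radix class, mod `hX = ExplicitRatExpApprox` ONLY.** -/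
theorem schanuel_inRadixClass (hX : ExplicitRatExpApprox) (n : ℕ) (z : Fin n → ℂ) (hz : InRadixClass z) :
    SB n z := by
  obtain ⟨T, w, e, hT0, hT, hu, hv, hv0, hLI, hz⟩ := hz
  have hai : AlgebraicIndependent ℚ (radixPt w e (T : ℂ) ∘ Fin.succ) :=
    (algebraicIndependent_radixPt hX w e hT0 hT hu hv hv0 hLI).comp _ (Fin.succ_injective n)
  refine natCast_le_trdeg_of_algebraicIndependent hai fun i => IntermediateField.subset_adjoin ℚ _ (Or.inr ⟨i, ?_⟩)
  simp only [Function.comp_apply, radixPt_succ, hz i]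

/-- `S`'s LITERAL SHAPE on the mixed class, mod `hX`. -/
theorem schanuel_shape_inRadixClass (hX : ExplicitRatExpApprox) : ∀ (n : ℕ) (z : Fin n → ℂ), LinearIndependent ℚ z →
    InRadixClass z →
      (n : Cardinal) ≤ Algebra.trdeg ℚ
        ↥(IntermediateField.adjoin ℚ (Set.range z ∪ Set.range (Complex.exp ∘ z))) :=
  fun n z _ hcl => schanuel_inRadixClass hX n z hcl

/-- **CELL of item 25020 `DefectOneSchanuel`** (Tier 2) — binders VERBATIM, ONE class line `InRadixClass z`; mod `hX`. -/
theorem cell_25020 (hX : ExplicitRatExpApprox) : ∀ (n : ℕ) (z : Fin n → ℂ), LinearIndependent ℚ z →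
    InRadixClass z →
      (n : Cardinal) ≤ Algebra.trdeg ℚ
        ↥(IntermediateField.adjoin ℚ (Set.range z ∪ Set.range (Complex.exp ∘ z))) + 1 :=
  fun n z _ hcl => (schanuel_inRadixClass hX n z hcl).trans le_self_add

/-- **CELL of item 31410 `PlainDefectOne`** (Tier 2) — binders VERBATIM (no-stabiliser and first-failure hypotheses
CARRIED, not consumed), ONE class line `InRadixClass z`; mod `hX`.  (Item 31409 `EStableDefectOne` is NOT served
by this file: OBSERVATION, not a theorem here — a span `ℚ·z` containing a weight `v·log 2 ≠ 0` next to a rational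
weight admits no algebraic irrational stabiliser `β`; we do not formalise this and claim nothing on 31409.) -/
theorem cell_31410 (hX : ExplicitRatExpApprox) : ∀ (n : ℕ) (z : Fin n → ℂ), LinearIndependent ℚ z →
    (∀ β : ℂ, IsAlgebraic ℚ β → (∀ i, β * z i ∈ Submodule.span ℚ (Set.range z)) →
      β ∈ Set.range (algebraMap ℚ ℂ)) →
    (∀ (m : ℕ) (w : Fin m → ℂ), m < n → LinearIndependent ℚ w →
      (∀ j, w j ∈ Submodule.span ℚ (Set.range z)) →
        (m : Cardinal) ≤ Algebra.trdeg ℚ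
          ↥(IntermediateField.adjoin ℚ (Set.range w ∪ Set.range (Complex.exp ∘ w))) + 1) →
    InRadixClass z →
      (n : Cardinal) ≤ Algebra.trdeg ℚ
        ↥(IntermediateField.adjoin ℚ (Set.range z ∪ Set.range (Complex.exp ∘ z))) + 1 :=
  fun n z hli _ _ hcl => cell_25020 hX n z hli hcl

/-- Weights of the twin curve `(T, …, T^k, log 2·T, …, log 2·T^k)`: `(1,0)` on the first block, `(0,1)` on the second. -/
def wMix (k : ℕ) : Fin (k + k) → ℚ × ℚ := Fin.addCases (fun _ => ((1 : ℚ), (0 : ℚ))) (fun _ => ((0 : ℚ), (1 : ℚ)))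

/-- Exponents of the twin curve: `1, …, k, 1, …, k`. -/
def eMix (k : ℕ) : Fin (k + k) → ℕ := Fin.addCases (fun j => (j : ℕ) + 1) (fun j => (j : ℕ) + 1)

/-- The MIXED twin curve `zMix k T = (T, …, T^k, log 2·T, …, log 2·T^k)` (a member of `InRadixClass`). -/
def zMix (k : ℕ) (T : ℝ) : Fin (k + k) → ℂ := fun l => ρι (wMix k l) * (T : ℂ) ^ (eMix k l)

/-- Weights of the mixed twin member, left block: `(1, 0)`. -/
@[simp] theorem wMix_left (k : ℕ) (j : Fin k) : wMix k (Fin.castAdd k j) = ((1 : ℚ), (0 : ℚ)) := by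
  simp only [wMix, Fin.addCases_left]
/-- Weights of the mixed twin member, right block: `(0, 1)`. -/
@[simp] theorem wMix_right (k : ℕ) (j : Fin k) : wMix k (Fin.natAdd k j) = ((0 : ℚ), (1 : ℚ)) := by
  simp only [wMix, Fin.addCases_right]
/-- Exponents of the mixed twin member, left block: `j + 1`. -/
@[simp] theorem eMix_left (k : ℕ) (j : Fin k) : eMix k (Fin.castAdd k j) = (j : ℕ) + 1 := by
  simp only [eMix, Fin.addCases_left]
/-- Exponents of the mixed twin member, right block: `j + 1`. -/
@[simp] theorem eMix_right (k : ℕ) (j : Fin k) : eMix k (Fin.natAdd k j) = (j : ℕ) + 1 := by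
  simp only [eMix, Fin.addCases_right]
/-- `j.addNat k = Fin.natAdd k j`. -/
private theorem addNat_eq_natAdd (k : ℕ) (j : Fin k) : j.addNat k = Fin.natAdd k j := by
  ext; simp [Nat.add_comm]
/-- Weights of the mixed twin member at `j.addNat k`: `(0, 1)`. -/
@[simp] theorem wMix_addNat (k : ℕ) (j : Fin k) : wMix k (j.addNat k) = ((0 : ℚ), (1 : ℚ)) := by
  rw [addNat_eq_natAdd, wMix_right]
/-- Exponents of the mixed twin member at `j.addNat k`: `j + 1`. -/
@[simp] theorem eMix_addNat (k : ℕ) (j : Fin k) : eMix k (j.addNat k) = (j : ℕ) + 1 := by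
  rw [addNat_eq_natAdd, eMix_right]

/-- Coordinates of the mixed twin member, left block: `T^{j+1}`. -/
theorem zMix_left (k : ℕ) (T : ℝ) (j : Fin k) : zMix k T (Fin.castAdd k j) = (T : ℂ) ^ ((j : ℕ) + 1) := by
  simp only [zMix, wMix_left, eMix_left, ρι, ρr]; push_cast; ring

/-- Coordinates of the mixed twin member, right block: `log 2 · T^{j+1}`. -/
theorem zMix_right (k : ℕ) (T : ℝ) (j : Fin k) :
    zMix k T (Fin.natAdd k j) = ((Real.log 2 : ℝ) : ℂ) * (T : ℂ) ^ ((j : ℕ) + 1) := by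
  simp only [zMix, wMix_right, eMix_right, ρι, ρr]; push_cast; ring

/-- `e^{z}` along the twin curve: `e^{T^{j+1}}` on the first block, `2^{T^{j+1}}` on the second. -/
theorem exp_zMix_right (k : ℕ) (T : ℝ) (j : Fin k) :
    cexp (zMix k T (Fin.natAdd k j)) = (((2 : ℝ) ^ (T ^ ((j : ℕ) + 1) : ℝ) : ℝ) : ℂ) := by
  rw [zMix_right, Real.rpow_def_of_pos two_pos, Complex.ofReal_exp]
  push_cast
  ring_nf

/-- The twin monomials `X^{j+1}` and `i·X^{j+1}` (`j < k`) are `ℤ`-free. -/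
theorem linearIndependent_mixMonomials (k : ℕ) :
    LinearIndependent ℤ (fun l : Fin (k + k) => Polynomial.monomial (eMix k l) (gι (wMix k l))) := by
  classical
  rw [Fintype.linearIndependent_iff]
  intro c hc
  rw [Fin.sum_univ_add] at hc
  simp only [wMix_left, wMix_right, eMix_left, eMix_right] at hc
  have hI0 : gι ((1 : ℚ), (0 : ℚ)) = 1 := by simp [gι]
  have hI1 : gι ((0 : ℚ), (1 : ℚ)) = I := by simp [gι]
  rw [hI0, hI1] at hc
  have key : ∀ j₀ : Fin k, (c (Fin.castAdd k j₀) : ℂ) + (c (Fin.natAdd k j₀) : ℂ) * I = 0 := by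
    intro j₀
    have h := congrArg (fun p : ℂ[X] => p.coeff ((j₀ : ℕ) + 1)) hc
    simp only [Polynomial.coeff_add, Polynomial.finsetSum_coeff, Polynomial.coeff_smul,
      Polynomial.coeff_monomial, Polynomial.coeff_zero] at h
    have hne : ∀ b : Fin k, b ≠ j₀ → ¬ ((b : ℕ) + 1 = (j₀ : ℕ) + 1) := fun b hb h' =>
      hb (Fin.ext (by omega))
    rw [Finset.sum_eq_single j₀ (fun b _ hb => by rw [if_neg (hne b hb), smul_zero])
        (fun h' => (h' (Finset.mem_univ _)).elim),
      Finset.sum_eq_single j₀ (fun b _ hb => by rw [if_neg (hne b hb), smul_zero])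
        (fun h' => (h' (Finset.mem_univ _)).elim)] at h
    simpa [zsmul_eq_mul] using h
  intro l
  induction l using Fin.addCases with
  | left j => have := congrArg Complex.re (key j); simpa using this
  | right j => have := congrArg Complex.im (key j); simpa using this

/-- The twin curve at `T > 0` of exponential order `13·k(k+1) + 4` lies in the mixed radix class (HYPOTHESIS-FREE
membership; note some weights `v_l = 1 ≠ 0`: `log 2` IS present). -/
theorem zMix_mem {k : ℕ} {T : ℝ} (hT0 : 0 < T) (hT : LiouvilleOrder (13 * (∑ l, eMix k l) + 4) T) :
    InRadixClass (zMix k T) :=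
  ⟨T, wMix k, eMix k, hT0, hT, fun l => by induction l using Fin.addCases <;> simp,
    fun l => by induction l using Fin.addCases <;> simp,
    fun l h => by induction l using Fin.addCases <;> simp at h, linearIndependent_mixMonomials k, fun _ => rfl⟩

/-- **MEMBER THEOREM (Tier 2, mod `hX`)**: `S` itself — `trdeg_ℚ ℚ(z, e^z) ≥ 2k` — at the twin curve
`(T,…,T^k, log 2·T,…, log 2·T^k)`, i.e. `e^T,…,e^{T^k}, 2^T,…,2^{T^k}` algebraically independent, for EVERY real
`T > 0` of exponential order `13·Σe + 4`. -/
theorem schanuel_zMix (hX : ExplicitRatExpApprox) {k : ℕ} {T : ℝ} (hT0 : 0 < T)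
    (hT : LiouvilleOrder (13 * (∑ l, eMix k l) + 4) T) : SB (k + k) (zMix k T) :=
  schanuel_inRadixClass hX _ _ (zMix_mem hT0 hT)

/-- **THE NAMED TIER-2 MEMBER** at a tower number (finite order, NOT hyper-Liouville by tree name). -/
theorem schanuel_zMix_towerNumber (hX : ExplicitRatExpApprox) (k : ℕ) :
    SB (k + k) (zMix k (towerNumber (13 * (∑ l, eMix k l) + 4 + 1))) ∧
      ¬ HyperLiouville (towerNumber (13 * (∑ l, eMix k l) + 4 + 1)) :=
  ⟨schanuel_zMix hX (towerNumber_pos (by omega)) (liouvilleOrder_towerNumber _),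
    not_hyperLiouville_towerNumber (by omega)⟩

end Cells

end Summit.Schanuel.Schanuel.Theorems.RootDecomp1ERadixCell

end
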